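/-
Copyright (c) 2026 the pub-hodgecm-mathlib formalisation cell (harness21).  Prover seat hodgecm-mathlib-LH4-p18 (g4), req620 Track A «(D-RAM) FOUR-FRAME» squad
(STAGE-1b, row (2) of the piece `f_{T₊}`, the (β₂) road (R-36) «PURE-CELL LEDGER»; K6 desk LH4-p16 (g3) WORDS #17 ∕ #18 (c) «A3 — THE DENSITY ON `Rd⋆`, OWNER LH4-p18»), 2026-09-05.
-/
import Summits.HodgeConjecture.HodgeConjecture.Theorems.F0P3cDyRamUniformDensityFromTables        -- ★ p864447 (LH7-p06 (g3)): `density_of_tables` (the arithmetic of the two tables)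
import Summits.HodgeConjecture.HodgeConjecture.Theorems.F0P3cDyRamBeta2ConesRowSizesAllD            -- ★ p864432 (LH7-p06 (g3)): the n-table `rowSize_near ∕ _boundary_* ∕ _far_*` (+ ★ `rowSize_diag`, `two_le_d`)
import Summits.HodgeConjecture.HodgeConjecture.Theorems.F0P3cDyRamRowCellDigitClassBalanceDress   -- ★ p864727 (LH7-p08 (g3)): `two_mul_card_filter_class_ball_eq ∕ _level_eq`, `filter_sphere_*`; brings ★ p864600 `filter_class_of_far`, ★ p864509 totals, ★ p864361
import Summits.HodgeConjecture.HodgeConjecture.Theorems.F0P3cDyRamRowCellDigitClassBoundary       -- ★ p864685 (LH4-p11 (g11)): `two_mul_card_filter_class_boundary ∕ _class'_boundary`, `hLBd_of_boundary`, `exists_slope`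
import HarnessLib

/-!
# Crux `H413`, line LH4 «(D-RAM) FOUR-FRAME» — STAGE-1b, row (2), the (β₂) road (R-36), K6 assembly A3: «THE DENSITY ON `Rd⋆`» — one integer `k` with
# `n_t(i) = k · #(Rd⋆.filter (LIT_t i))` on every inside cell `i < N` of the live row, both literals `t ∈ {H, A}` (the `hk_t` letters of the K6-(e) spine)

Cell `hodgecm-mathlib` (D-0151), FLOOR 0, crux item H413 = `stmt-HodgeConjecture-24833`, route of record `HCCMUnconditional`; squad F0∕P3c∕LH4; lane
`--supports stmt-HodgeConjecture-24833 --as helper` (count-neutral; pays NO tier-0 row).  THEOREMS ONLY (no `def`, no instance, no notation, no `sorry`, default heartbeats);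
★-only imports; states NO law; ‹CORE›∕(β₂) stay HYPOTHESES.
WHAT.  Frame = ‹CORE.letter.v1› (dd6c93c2)'s, a subset BY NAME AND BYTE: the general letters, the hyperbolic literal `((StdForm.antidiagonal 2).over E, 1; γ₂, φ, h, f)` with its isotropic
vector `hhyper`, the anisotropic literal `(Matrix.diagonal dg, η; γ₁, φ′, h′, f′)` with `σ dg = dg`, `ση = η`, `|η| = 1`, `η ∉ N(E^×)`, the frame equation `hA`, and its anisotropy
`haniso` (the letter's premise); the row `1 ≤ b`, `2b = m`; the window `1 ≤ N`, `m + 2N = jl`; A1's chart (★ p864708) AS BINDERS: `κ₀ + ρκ₀ = 1`, `Θκ₀ = κ₀`, `|κ₀| = 1`, `ρξ₀ = −ξ₀`,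
`Θξ₀ = ξ₀`, `|ξ₀| = exp 2(N − 1)`; a σ-fixed integral digit system `Rd` complete and irredundant modulo `|ϖ|^n` with `2(N−1) + (2d−1) ≤ n ≤ 2(N−1) + 4b` (A2's `n⋆ = b + 2(N−1)`
qualifies under the K6 floor `b ≥ 2d`).  THEN **`∃ k : ℤ, ∀ i < N, n_H(i) = k·#(Rd.filter (LIT_H i)) ∧ (i < d → n_A(i) = k·#(Rd.filter (LIT_A i)))`**, where `n_t(i)` = the letters' weighted size
`((Σᶠ_{Λ ∈ levelSetDep … h_t (b+2i) b μ} f_t b (b+2i) Λ : ℕ) : ℤ)` and `LIT_t i` = ★ F1b p864627's literal-digit lambda at `j := b + 2i` (sphere ∧ class, scalar `h_tρh_t`).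
MECHANISM: ★ `density_of_tables` (pure arithmetic) fed by NAME: the n-table ★ `rowSize_diag` (`n(b,b) = q^b·q^b`) and ★ p864432 `rowSize_near` (both literals), `rowSize_boundary_hyp_allD ∕
_aniso_allD`, `rowSize_far_hyp_allD ∕ _aniso_allD` (frame bit = `hhyper ∕ haniso`); the L-table in the chart: F1b's sphere conjunct is `max 1 (|V|·|ξ₀|) = exp 2i` (★ p864361
`v_traceOne_add_map_mul_anti_eq_max`, `radius_letters`), i.e. the ball `|V| ≤ |ϖ|^{2(N−1)}` (`i = 0`) ∕ the level `|V| = |ϖ|^{2(N−1−i)}` (★ p864727 §1); then ★ p864727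
`two_mul_card_filter_class_ball_eq ∕ _level_eq` (diagonal + inner: half∕half, ANY doubly-fixed scalar), ★ p864685 `two_mul_card_filter_class_boundary ∕ _class'_boundary` +
`hLBd_of_boundary` (boundary `(q−2) : q`, slope ★ `exists_slope`), ★ p864600 `filter_class_of_far` (far: one-class) with ★ p864509 `card_filter_shell_eq_mul_card_ball`; `β := #(Rd ∩ ball)
= q^{(n − 2(N−1) + 1)∕2}` (★ p864509 `card_filter_ball_eq`), `k := 2·q^{2b − (n − 2(N−1) + 1)∕2}` (integral by `n ≤ 2(N−1) + 4b`).
WHAT IS NOT CLAIMED: the per-cell laws (A2, LH4-p15), the window identity (A4, LH4-p11), the top cell (A5), any census law; ‹CORE› stays OPEN.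
HONEST LABEL.  Count-neutral assembly of ★ tables; nothing printed is asserted; no census law is stated; `HC_CM` is proved only modulo the 7 printed citations (2 remaining named inputs:
hLiu418 = `stmt-HodgeConjecture-24832`, h413 = `stmt-HodgeConjecture-24833`) until rung 0 closes.
## References
* [Kottwitz1986BaseChangeUnits] R. E. Kottwitz, *Base change for unit elements of Hecke algebras*, Compositio Math. 60 (1986): §1 pp. 240–241 (cell-by-cell weighted lattice counts).
* [Flicker1998UnitaryFL] Y. Z. Flicker, *Elementary proof of the fundamental lemma for a unitary group*, Canad. J. Math. 50 (1998): Prop. 7 p. 84 (the level tables).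
* [LabesseLanglands1979] J.-P. Labesse, R. P. Langlands, *L-indistinguishability for SL(2)*, Canad. J. Math. 31 (1979): §2 (2.2) p. 9 (κ-signed counts).
* [Serre1979] J.-P. Serre, *Local Fields*, GTM 67 (1979): Ch. V §3 Prop. 5, Cor. 2–3 pp. 84–86; Ch. IV §2 Prop. 6 (residue counts).
-/

set_option autoImplicit false

noncomputable section

namespace Summit.HodgeConjecture.HodgeConjecture.Cruxes.H413.F0P3cDyRamInsideCellsDensity

open scoped Valued WithZero Matrix MatrixGroups Classical
open WithZero Finset
open Literature.NumberTheory.Automorphic Literature.NumberTheory.Automorphic.HermitianLattice Literature.NumberTheory.Automorphic.UnitaryLatticeTree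
open Literature.NumberTheory.Automorphic.UnitaryThreeFourFrame (IsRamifiedQuadraticDatum)
open Literature.NumberTheory.Rogawski1990
open Summit.HodgeConjecture.HodgeConjecture.Cruxes.H413.F0P3cDyRamFourFramePieces
open Summit.HodgeConjecture.HodgeConjecture.Cruxes.H413.F0P3cDyRamToricCensusDefs
open Summit.HodgeConjecture.HodgeConjecture.Cruxes.H413.F0P3cDyRamUniformDensityFromTables (density_of_tables)
open Summit.HodgeConjecture.HodgeConjecture.Cruxes.H413.F0P3cDyRamBeta2ConesRowSizes (two_le_d rowSize_diag)
open Summit.HodgeConjecture.HodgeConjecture.Cruxes.H413.F0P3cDyRamBeta2ConesRowSizesAllD (rowSize_near rowSize_boundary_hyp_allD rowSize_boundary_aniso_allD rowSize_far_hyp_allD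
  rowSize_far_aniso_allD)
open Summit.HodgeConjecture.HodgeConjecture.Cruxes.H413.F0P3cDyRamRowCellDigitShellDictionary (v_traceOne_add_map_mul_anti_eq_max radius_letters)
open Summit.HodgeConjecture.HodgeConjecture.Cruxes.H413.F0P3cDyRamRowCellDigitClassBalanceDress (filter_sphere_one_eq_filter_ball filter_sphere_eq_filter_level
  two_mul_card_filter_class_ball_eq two_mul_card_filter_class_level_eq)
open Summit.HodgeConjecture.HodgeConjecture.Cruxes.H413.F0P3cDyRamRowCellDigitClassBalance (filter_class_of_far)
open Summit.HodgeConjecture.HodgeConjecture.Cruxes.H413.F0P3cDyRamRowCellDigitClassBoundary (exists_slope two_mul_card_filter_class_boundary two_mul_card_filter_class'_boundary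
  hLBd_of_boundary)
open Summit.HodgeConjecture.HodgeConjecture.Cruxes.H413.F0P3cDyRamOneChartDigitTotals (card_filter_ball_eq card_filter_shell_eq_mul_card_ball)

variable {E M : Type} [Field E] [Valued E ℤᵐ⁰] [Field M] [Valued M ℤᵐ⁰]

/-! ## §1 The literal-digit filter of cell `i` in the chart is the ball ∕ level filter refined by the class -/

/-- **F1b's SPHERE CONJUNCT AT `j = b + 2i` READS `max 1 (|V|·|ξ₀|) = exp 2i`** (`κ₀` of trace one with `|κ₀| = 1`, `ρξ₀ = −ξ₀`; `|jE a| = |a|`, `|ϖ| = exp(−1)`, `|α − ρα| = 1`).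
[cite: Serre1979, Ch. II §4 Prop. 5 p. 32] -/
theorem sphereClause_cell_iff {ρ : M →+* M} {α : M} (hvρ : ∀ x, Valued.v (ρ x) = Valued.v x) (jE : E →+* M) (hρj : ∀ c, ρ (jE c) = jE c)
    (hjiso : ∀ a, Valued.v (jE a) = Valued.v a) {ϖ : E} (hϖ : Valued.v ϖ = exp (-1 : ℤ)) (hU : Valued.v (α - ρ α) = 1)
    {κ₀ ξ₀ : M} (hκ₀ : κ₀ + ρ κ₀ = 1) (hκ₀1 : Valued.v κ₀ = 1) (hξ : ρ ξ₀ = -ξ₀) (b i : ℕ) (V : E) :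
    Valued.v (κ₀ + jE V * ξ₀) * Valued.v (jE ϖ ^ (b + 2 * i) * (α - ρ α)) = Valued.v (jE ϖ) ^ b ↔ max 1 (Valued.v V * Valued.v ξ₀) = exp (2 * (i : ℤ)) := by
  obtain ⟨hcc, hbb⟩ := radius_letters jE hjiso hϖ hU (b + 2 * i) b
  rw [v_traceOne_add_map_mul_anti_eq_max hvρ jE hρj hjiso hκ₀ hκ₀1 hξ V, hcc, hbb, ← eq_div_iff exp_ne_zero, ← exp_sub,
    show (-(b : ℤ)) - -((b + 2 * i : ℕ) : ℤ) = 2 * (i : ℤ) by push_cast; ring]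

/-! ## §2 HEAD — the density `k` -/

/-- **HEAD — A3 «THE DENSITY ON `Rd⋆`».**  ‹CORE.letter.v1›'s frame (subset by name), the live row, the window `m + 2N = jl`, A1's chart as binders, a σ-fixed integral digit system
modulo `|ϖ|^n` with `2(N−1) + (2d−1) ≤ n ≤ 2(N−1) + 4b`.  THEN `∃ k : ℤ, ∀ i < N, n_H(i) = k·#(Rd.filter (LIT_H i)) ∧ (i < d → n_A(i) = k·#(Rd.filter (LIT_A i)))` — ★ `density_of_tables`
fed by the ★ n-table and the ★ digit counts of the one chart (module docstring).
[cite: Kottwitz1986BaseChangeUnits, §1 pp. 240–241] [cite: Flicker1998UnitaryFL, Prop. 7 p. 84] [cite: LabesseLanglands1979, §2 (2.2) p. 9] [cite: Serre1979, Ch. V §3 Cor. 3; Ch. IV §2 Prop. 6] -/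
theorem exists_density_insideCells [CompleteSpace E] [IsDiscreteValuationRing 𝒪[E]] [Finite 𝓀[E]] [CompleteSpace M] [IsDiscreteValuationRing 𝒪[M]] [Finite 𝓀[M]]
    (σ : E →+* E) (ϖ : E) (d tE : ℕ) (hD : IsRamifiedQuadraticDatum σ ϖ d tE) (hσσ : ∀ a, σ (σ a) = a) (h2 : ¬ IsUnit (2 : 𝒪[E]))
    (jE : E →+* M) (ρ Θ : M →+* M) (α lam : M)
    (hρρ : ∀ z, ρ (ρ z) = z) (hvρ : ∀ z, Valued.v (ρ z) = Valued.v z) (hρj : ∀ a, ρ (jE a) = jE a)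
    (hjv : ∀ a, Valued.v (jE a) ≤ 1 ↔ Valued.v a ≤ 1) (hjfix : ∀ z : M, ρ z = z ↔ ∃ a, jE a = z) (hΘj : ∀ a, Θ (jE a) = jE (σ a))
    (hΘΘ : ∀ z, Θ (Θ z) = z) (hΘρ : ∀ z, Θ (ρ z) = ρ (Θ z)) (hvΘ : ∀ z, Valued.v (Θ z) = Valued.v z)
    (hα : ρ α ≠ α) (hα1 : Valued.v α ≤ 1) (hint : ∀ z : M, Valued.v z ≤ 1 → Valued.v ((z - ρ z) / (α - ρ α)) ≤ 1) (hvlam : Valued.v lam = 1)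
    (hU : Valued.v (α - ρ α) = 1) (hτ : Valued.v (α - Θ α) < 1) (hσres : ∀ z : M, ρ z = z → Valued.v z ≤ 1 → Valued.v (Θ z - z) < 1)
    (hDM : IsRamifiedQuadraticDatum Θ (jE ϖ) d tE) (hjiso : ∀ a, Valued.v (jE a) = Valued.v a) (hq : Nat.card 𝓀[M] = Nat.card 𝓀[E] ^ 2)
    (hjpow : ∀ (t : E) (n : ℤ), Valued.v (jE t) = Valued.v (jE ϖ) ^ n ↔ Valued.v t = Valued.v ϖ ^ n)
    (hϖmax : ∀ t : M, ρ t = t → Valued.v t < 1 → Valued.v t ≤ Valued.v (jE ϖ))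
    (γ₂ : GL (Fin 2) E) (u : GL (Fin 1) E) (m jl : ℕ) (hm : Valued.v (lam - jE ((u : Matrix (Fin 1) (Fin 1) E) 0 0)) = WithZero.exp (-(m : ℤ)))
    (hjl : Valued.v ((lam - jE ((u : Matrix (Fin 1) (Fin 1) E) 0 0)) - ρ (lam - jE ((u : Matrix (Fin 1) (Fin 1) E) 0 0))) = WithZero.exp (-(jl : ℤ)))
    (P₁ : GL (Fin 3) E) (dg : Fin 2 → E) (η : E) (γ₁ : GL (Fin 2) E)
    (hA : formCongr σ P₁ ((StdForm.antidiagonal 3).over E) =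
      (!![(Matrix.diagonal dg) 0 0, 0, (Matrix.diagonal dg) 0 1; 0, η, 0; (Matrix.diagonal dg) 1 0, 0, (Matrix.diagonal dg) 1 1] : Matrix (Fin 3) (Fin 3) E))
    (hdgσ : ∀ i, σ (dg i) = dg i) (hησ : σ η = η) (hη1 : Valued.v η = 1) (hηN : ¬ ∃ t : E, t * σ t = η)
    (φ : (Fin 2 → E) →+ M) (h : M) (φ' : (Fin 2 → E) →+ M) (h' : M)
    (hφs : ∀ (c : E) (x : Fin 2 → E), φ (c • x) = jE c * φ x) (hφi : Function.Injective φ) (hφo : Function.Surjective φ)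
    (hφγ : ∀ x, φ ((γ₂ : Matrix (Fin 2) (Fin 2) E).mulVec x) = lam * φ x)
    (hform : ∀ x y, jE (pairing σ ((StdForm.antidiagonal 2).over E) x y) = h * Θ (φ x) * φ y + ρ (h * Θ (φ x) * φ y)) (hΘh : Θ h = h) (hh : h ≠ 0)
    (hhyper : ∃ x : M, x ≠ 0 ∧ h * Θ x * x + ρ (h * Θ x * x) = 0)
    (hφ's : ∀ (c : E) (x : Fin 2 → E), φ' (c • x) = jE c * φ' x) (hφ'i : Function.Injective φ') (hφ'o : Function.Surjective φ')
    (hφ'γ : ∀ x, φ' ((γ₁ : Matrix (Fin 2) (Fin 2) E).mulVec x) = lam * φ' x)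
    (hform' : ∀ x y, jE (pairing σ (Matrix.diagonal dg) x y) = h' * Θ (φ' x) * φ' y + ρ (h' * Θ (φ' x) * φ' y)) (hΘh' : Θ h' = h') (hh' : h' ≠ 0)
    (haniso : ¬ ∃ x : M, x ≠ 0 ∧ h' * Θ x * x + ρ (h' * Θ x * x) = 0)
    (f f' : ℕ → ℕ → AddSubgroup M → ℕ)
    (hfinLS : ∀ j a, (levelSet ρ Θ α (jE ϖ) h j a).Finite) (hfinLS' : ∀ j a, (levelSet ρ Θ α (jE ϖ) h' j a).Finite)
    (hf : ∀ (b j : ℕ) (Λ : AddSubgroup M) (x₀ : M) (r : E), 1 ≤ b → x₀ ≠ 0 → (∀ x, x ∈ Λ ↔ ∃ z, IsOrd ρ α (jE ϖ ^ j) z ∧ x = x₀ * z) →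
      IsOrd ρ α (jE ϖ ^ j) (dualGen ρ Θ α (jE ϖ ^ j) h x₀) → ¬ IsOrd ρ α (jE ϖ ^ j) (dualGen ρ Θ α (jE ϖ ^ j) h x₀ / jE ϖ) → Valued.v (dualGen ρ Θ α (jE ϖ ^ j) h x₀) = Valued.v (jE ϖ) ^ b →
      (∀ b', (∀ x ∈ Λ, Valued.v (h * Θ x * b' + ρ (h * Θ x * b')) ≤ 1) → (lam - jE ((u : Matrix (Fin 1) (Fin 1) E) 0 0)) * b' ∈ Λ) → IsOrd ρ α (jE ϖ ^ j) lam →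
      jE r = glueUnit ρ Θ α (jE ϖ ^ j) h (jE ϖ) (jE 1) x₀ b →
      f b j Λ = Nat.card {x : 𝒪[E] ⧸ 𝓂[E] ^ (2 * b) // ∃ u' : 𝒪[E], Ideal.Quotient.mk (𝓂[E] ^ (2 * b)) u' = x ∧ Valued.v ((u' : E) * σ u' - r) ≤ Valued.v (ϖ ^ (2 * b))})
    (hf' : ∀ (b j : ℕ) (Λ : AddSubgroup M) (x₀ : M) (r : E), 1 ≤ b → x₀ ≠ 0 → (∀ x, x ∈ Λ ↔ ∃ z, IsOrd ρ α (jE ϖ ^ j) z ∧ x = x₀ * z) →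
      IsOrd ρ α (jE ϖ ^ j) (dualGen ρ Θ α (jE ϖ ^ j) h' x₀) → ¬ IsOrd ρ α (jE ϖ ^ j) (dualGen ρ Θ α (jE ϖ ^ j) h' x₀ / jE ϖ) →
      Valued.v (dualGen ρ Θ α (jE ϖ ^ j) h' x₀) = Valued.v (jE ϖ) ^ b →
      (∀ b', (∀ x ∈ Λ, Valued.v (h' * Θ x * b' + ρ (h' * Θ x * b')) ≤ 1) → (lam - jE ((u : Matrix (Fin 1) (Fin 1) E) 0 0)) * b' ∈ Λ) → IsOrd ρ α (jE ϖ ^ j) lam →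
      jE r = glueUnit ρ Θ α (jE ϖ ^ j) h' (jE ϖ) (jE η) x₀ b →
      f' b j Λ = Nat.card {x : 𝒪[E] ⧸ 𝓂[E] ^ (2 * b) // ∃ u' : 𝒪[E], Ideal.Quotient.mk (𝓂[E] ^ (2 * b)) u' = x ∧ Valued.v ((u' : E) * σ u' - r) ≤ Valued.v (ϖ ^ (2 * b))})
    -- the row and the window
    (b : ℕ) (hb1 : 1 ≤ b) (hb2 : 2 * b = m) (N : ℕ) (hN1 : 1 ≤ N) (hNjl : m + 2 * N = jl)
    -- A1's chart, as binders
    {κ₀ ξ₀ : M} (hκ₀ : κ₀ + ρ κ₀ = 1) (hΘκ₀ : Θ κ₀ = κ₀) (hκ₀1 : Valued.v κ₀ = 1) (hξ : ρ ξ₀ = -ξ₀) (hΘξ : Θ ξ₀ = ξ₀)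
    (hξN : Valued.v ξ₀ = exp (2 * ((N : ℤ) - 1)))
    -- the fine digit system
    (Rd : Finset E) {n : ℕ} (hRd1 : ∀ V ∈ Rd, σ V = V ∧ Valued.v V ≤ 1)
    (hRd2 : ∀ V : E, σ V = V → Valued.v V ≤ 1 → ∃ V₀ ∈ Rd, Valued.v (V - V₀) ≤ Valued.v ϖ ^ n)
    (hRd3 : ∀ V ∈ Rd, ∀ V' ∈ Rd, Valued.v (V - V') ≤ Valued.v ϖ ^ n → V = V')
    (hn : 2 * (N - 1) + (2 * d - 1) ≤ n) (hn4 : n ≤ 2 * (N - 1) + 4 * b) :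
    ∃ k : ℤ, ∀ i : ℕ, i < N →
      ((∑ᶠ Λ ∈ levelSetDep ρ Θ α (jE ϖ) h (b + 2 * i) b (lam - jE ((u : Matrix (Fin 1) (Fin 1) E) 0 0)), f b (b + 2 * i) Λ : ℕ) : ℤ) =
          k * ((Rd.filter fun V₀ : E => Valued.v (κ₀ + jE V₀ * ξ₀) * Valued.v (jE ϖ ^ (b + 2 * i) * (α - ρ α)) = Valued.v (jE ϖ) ^ b ∧
            ∃ e : M, ρ e = e ∧ e * Θ e = (κ₀ + jE V₀ * ξ₀) * ρ (κ₀ + jE V₀ * ξ₀) / (h * ρ h)).card : ℤ) ∧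
      (i < d →
        ((∑ᶠ Λ ∈ levelSetDep ρ Θ α (jE ϖ) h' (b + 2 * i) b (lam - jE ((u : Matrix (Fin 1) (Fin 1) E) 0 0)), f' b (b + 2 * i) Λ : ℕ) : ℤ) =
          k * ((Rd.filter fun V₀ : E => Valued.v (κ₀ + jE V₀ * ξ₀) * Valued.v (jE ϖ ^ (b + 2 * i) * (α - ρ α)) = Valued.v (jE ϖ) ^ b ∧
            ∃ e : M, ρ e = e ∧ e * Θ e = (κ₀ + jE V₀ * ξ₀) * ρ (κ₀ + jE V₀ * ξ₀) / (h' * ρ h')).card : ℤ)) := by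
  obtain ⟨-, -, hϖ, -, -, -, -⟩ := id hD
  obtain ⟨h2v, hd2⟩ := two_le_d hD h2
  have hϖn : ∀ k : ℕ, Valued.v ϖ ^ k = exp (-(k : ℤ)) := fun k => by rw [hϖ, ← exp_nsmul, nsmul_eq_mul, mul_neg, mul_one]
  have hq1 : 1 ≤ Nat.card 𝓀[E] := Nat.card_pos
  have hξN' : Valued.v ξ₀ = exp (2 * ((N - 1 : ℕ) : ℤ)) := by rw [hξN, Nat.cast_sub hN1, Nat.cast_one]
  have hξ0 : ξ₀ ≠ 0 := fun h0 => by rw [h0, Valuation.map_zero] at hξN; exact exp_ne_zero hξN.symm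
  -- the two literals' hermitian letters (as in ★ `row_of_core`)
  have hH₂σ : ((((StdForm.antidiagonal 2).over E).map σ))ᵀ = (StdForm.antidiagonal 2).over E := by rw [StdForm.over_map, StdForm.transpose_over]
  have hH₂σ' : ((Matrix.diagonal dg).map σ)ᵀ = Matrix.diagonal dg := by
    rw [Matrix.diagonal_map (map_zero _), Matrix.diagonal_transpose]; exact congrArg Matrix.diagonal (funext hdgσ)
  have h1v : Valued.v (1 : E) = 1 := Valuation.map_one _
  have h1σ : σ 1 = 1 := map_one σ
  -- the doubly-fixed scalars of the two literals
  have hρc : ρ (h * ρ h) = h * ρ h := by rw [map_mul, hρρ, mul_comm]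
  have hΘc : Θ (h * ρ h) = h * ρ h := by rw [map_mul, hΘρ, hΘh]
  have hc0 : h * ρ h ≠ 0 := mul_ne_zero hh ((map_ne_zero ρ).2 hh)
  have hρc' : ρ (h' * ρ h') = h' * ρ h' := by rw [map_mul, hρρ, mul_comm]
  have hΘc' : Θ (h' * ρ h') = h' * ρ h' := by rw [map_mul, hΘρ, hΘh']
  have hc0' : h' * ρ h' ≠ 0 := mul_ne_zero hh' ((map_ne_zero ρ).2 hh')
  -- (n) the diagonal sizes `n_t(b, b) = q^b·q^b`
  have hnD := rowSize_diag hD hσσ h2 hρρ hvρ hρj hjv hjfix hΘj hΘΘ hΘρ hvΘ hα hα1 hint hvlam hU hτ hσres hDM hjiso hq hjpow hϖmax hm hjl hH₂σ h1v h1σ hφs hφi hφo hφγ hform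
    hΘh hh hfinLS hf b hb2 hb1
  have hnD' := rowSize_diag hD hσσ h2 hρρ hvρ hρj hjv hjfix hΘj hΘΘ hΘρ hvΘ hα hα1 hint hvlam hU hτ hσres hDM hjiso hq hjpow hϖmax hm hjl hH₂σ' hη1 hησ hφ's hφ'i hφ'o hφ'γ
    hform' hΘh' hh' hfinLS' hf' b hb2 hb1
  have hqq : (Nat.card 𝓀[E] : ℤ) ^ b * (Nat.card 𝓀[E] : ℤ) ^ b = (Nat.card 𝓀[E] : ℤ) ^ (2 * b) := by rw [← pow_add, ← two_mul]
  -- (L) the literal-digit filter of cell `i` = the ball ∕ level filter refined by the class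
  have hLit : ∀ (i : ℕ) (c : M),
      (Rd.filter fun V₀ : E => Valued.v (κ₀ + jE V₀ * ξ₀) * Valued.v (jE ϖ ^ (b + 2 * i) * (α - ρ α)) = Valued.v (jE ϖ) ^ b ∧
          ∃ e : M, ρ e = e ∧ e * Θ e = (κ₀ + jE V₀ * ξ₀) * ρ (κ₀ + jE V₀ * ξ₀) / c) =
        (Rd.filter fun V => max 1 (Valued.v V * Valued.v ξ₀) = exp (2 * (i : ℤ))).filter
          fun V => ∃ e : M, ρ e = e ∧ e * Θ e = (κ₀ + jE V * ξ₀) * ρ (κ₀ + jE V * ξ₀) / c := by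
    intro i c
    rw [Finset.filter_filter]
    exact Finset.filter_congr fun V _ => by rw [sphereClause_cell_iff hvρ jE hρj hjiso hϖ hU hκ₀ hκ₀1 hξ b i V]
  have hball : (Rd.filter fun V => max 1 (Valued.v V * Valued.v ξ₀) = exp (2 * ((0 : ℕ) : ℤ))) =
      Rd.filter fun V => Valued.v V ≤ Valued.v ϖ ^ (2 * (N - 1)) := by
    rw [← filter_sphere_one_eq_filter_ball hϖ hξN' Rd]
    exact Finset.filter_congr fun V _ => by rw [Nat.cast_zero, mul_zero, exp_zero]
  have hlevel : ∀ i : ℕ, 1 ≤ i → i ≤ N - 1 → (Rd.filter fun V => max 1 (Valued.v V * Valued.v ξ₀) = exp (2 * (i : ℤ))) =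
      Rd.filter fun V => Valued.v V = Valued.v ϖ ^ (2 * (N - 1 - i)) := fun i hi1 hiN =>
    filter_sphere_eq_filter_level hϖ hξN' hi1 hiN Rd
  -- β and the density k
  have hβ := card_filter_ball_eq hD Rd hRd1 hRd2 hRd3 (N - 1) (by omega)
  have hβ0 : ((Rd.filter fun V => Valued.v V ≤ Valued.v ϖ ^ (2 * (N - 1))).card : ℤ) ≠ 0 := by
    rw [hβ]; exact_mod_cast pow_ne_zero _ (by omega)
  have hk : 2 * (Nat.card 𝓀[E] : ℤ) ^ (2 * b) =
      2 * (Nat.card 𝓀[E] : ℤ) ^ (2 * b - (n - 2 * (N - 1) + 1) / 2) * ((Rd.filter fun V => Valued.v V ≤ Valued.v ϖ ^ (2 * (N - 1))).card : ℤ) := by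
    rw [hβ, Nat.cast_pow, mul_assoc, ← pow_add]
    congr 2; omega
  -- the shell totals
  have hshell : ∀ i : ℕ, 1 ≤ i → i ≤ N - 1 → ((Rd.filter fun V => Valued.v V = Valued.v ϖ ^ (2 * (N - 1 - i))).card : ℤ) =
      ((Nat.card 𝓀[E] : ℤ) - 1) * ((Nat.card 𝓀[E] : ℤ) ^ (i - 1) * ((Rd.filter fun V => Valued.v V ≤ Valued.v ϖ ^ (2 * (N - 1))).card : ℤ)) := by
    intro i hi1 hiN
    rw [card_filter_shell_eq_mul_card_ball hD Rd hRd1 hRd2 hRd3 (by omega) i hi1 hiN, Nat.cast_mul, Nat.cast_mul, Nat.cast_sub hq1, Nat.cast_one, Nat.cast_pow,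
      mul_assoc]
  refine ⟨2 * (Nat.card 𝓀[E] : ℤ) ^ (2 * b - (n - 2 * (N - 1) + 1) / 2), fun i hi => ?_⟩
  have key := density_of_tables (Nat.card 𝓀[E] : ℤ) ((Rd.filter fun V => Valued.v V ≤ Valued.v ϖ ^ (2 * (N - 1))).card : ℤ)
    (2 * (Nat.card 𝓀[E] : ℤ) ^ (2 * b - (n - 2 * (N - 1) + 1) / 2)) b d N
    (fun i => ((∑ᶠ Λ ∈ levelSetDep ρ Θ α (jE ϖ) h (b + 2 * i) b (lam - jE ((u : Matrix (Fin 1) (Fin 1) E) 0 0)), f b (b + 2 * i) Λ : ℕ) : ℤ))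
    (fun i => ((∑ᶠ Λ ∈ levelSetDep ρ Θ α (jE ϖ) h' (b + 2 * i) b (lam - jE ((u : Matrix (Fin 1) (Fin 1) E) 0 0)), f' b (b + 2 * i) Λ : ℕ) : ℤ))
    (fun i => ((Rd.filter fun V₀ : E => Valued.v (κ₀ + jE V₀ * ξ₀) * Valued.v (jE ϖ ^ (b + 2 * i) * (α - ρ α)) = Valued.v (jE ϖ) ^ b ∧
      ∃ e : M, ρ e = e ∧ e * Θ e = (κ₀ + jE V₀ * ξ₀) * ρ (κ₀ + jE V₀ * ξ₀) / (h * ρ h)).card : ℤ))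
    (fun i => ((Rd.filter fun V₀ : E => Valued.v (κ₀ + jE V₀ * ξ₀) * Valued.v (jE ϖ ^ (b + 2 * i) * (α - ρ α)) = Valued.v (jE ϖ) ^ b ∧
      ∃ e : M, ρ e = e ∧ e * Θ e = (κ₀ + jE V₀ * ξ₀) * ρ (κ₀ + jE V₀ * ξ₀) / (h' * ρ h')).card : ℤ))
    hβ0 hk ?_ ?_ ?_ ?_ ?_ ?_ ?_ ?_ i hi
  · exact ⟨key.1, fun _ => key.2⟩
  -- (n0) the diagonal cell
  · intro _
    simp only [Nat.mul_zero, Nat.add_zero]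
    exact ⟨hnD.trans hqq, hnD'.trans hqq⟩
  -- (nNear) the inner towers, both literals
  · intro i hi1 hid hiN
    refine ⟨?_, ?_⟩
    · rw [rowSize_near hD hσσ h2 hρρ hvρ hρj hjv hjfix hΘj hΘΘ hΘρ hvΘ hα hα1 hint hvlam hU hτ hσres hDM hjiso hq hjpow hϖmax hm hjl hH₂σ h1v h1σ hφs hφi hφo hφγ
        hform hΘh hh hfinLS hf b hb2 hb1 i hi1 hid (by omega), hnD, hqq]
    · rw [rowSize_near hD hσσ h2 hρρ hvρ hρj hjv hjfix hΘj hΘΘ hΘρ hvΘ hα hα1 hint hvlam hU hτ hσres hDM hjiso hq hjpow hϖmax hm hjl hH₂σ' hη1 hησ hφ's hφ'i hφ'o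
        hφ'γ hform' hΘh' hh' hfinLS' hf' b hb2 hb1 i hi1 hid (by omega), hnD', hqq]
  -- (nBd) the boundary tower
  · intro i hi1 hid hiN
    refine ⟨?_, ?_⟩
    · rw [rowSize_boundary_hyp_allD hD hσσ h2 hρρ hvρ hρj hjv hjfix hΘj hΘΘ hΘρ hvΘ hα hα1 hint hvlam hU hτ hσres hDM hjiso hq hjpow hϖmax hm hjl hH₂σ h1v h1σ hφs
        hφi hφo hφγ hform hΘh hh hfinLS hf b hb2 hb1 hhyper i hid (by omega), hnD, hqq]
    · rw [rowSize_boundary_aniso_allD hD hσσ h2 hρρ hvρ hρj hjv hjfix hΘj hΘΘ hΘρ hvΘ hα hα1 hint hvlam hU hτ hσres hDM hjiso hq hjpow hϖmax hm hjl hH₂σ' hη1 hησ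
        hφ's hφ'i hφ'o hφ'γ hform' hΘh' hh' hfinLS' hf' b hb2 hb1 haniso i hid (by omega), hnD', hqq]
  -- (nFar) the far towers
  · intro i hi1 hdi hiN
    refine ⟨?_, ?_⟩
    · rw [rowSize_far_hyp_allD hD hσσ h2 hρρ hvρ hρj hjv hjfix hΘj hΘΘ hΘρ hvΘ hα hα1 hint hvlam hU hτ hσres hDM hjiso hq hjpow hϖmax hm hjl hH₂σ h1v h1σ hφs hφi
        hφo hφγ hform hΘh hh hfinLS hf b hb2 hb1 hhyper i hdi (by omega), hnD, hqq]
    · exact rowSize_far_aniso_allD hD hσσ h2 hρρ hvρ hρj hjv hjfix hΘj hΘΘ hΘρ hvΘ hα hα1 hint hvlam hU hτ hσres hDM hjiso hq hjpow hϖmax hm hjl hH₂σ' hη1 hησ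
        hφ's hφ'i hφ'o hφ'γ hform' hΘh' hh' hfinLS' hf' b hb2 hb1 haniso i hdi (by omega)
  -- (L0) the diagonal ball is balanced, both literals
  · intro _
    refine ⟨?_, ?_⟩
    · rw [hLit 0 (h * ρ h), hball]
      exact_mod_cast two_mul_card_filter_class_ball_eq hD h2v hd2 jE hjfix hΘj hjiso hρρ hvρ hΘρ hκ₀ hΘκ₀ hκ₀1 hξ hΘξ hξN' hρc hΘc hc0 Rd hRd1 hRd2 hRd3 hn
    · rw [hLit 0 (h' * ρ h'), hball]
      exact_mod_cast two_mul_card_filter_class_ball_eq hD h2v hd2 jE hjfix hΘj hjiso hρρ hvρ hΘρ hκ₀ hΘκ₀ hκ₀1 hξ hΘξ hξN' hρc' hΘc' hc0' Rd hRd1 hRd2 hRd3 hn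
  -- (LNear) the inner shells are balanced, both literals
  · intro i hi1 hid hiN
    refine ⟨?_, ?_⟩
    · rw [hLit i (h * ρ h), hlevel i hi1 (by omega)]
      have h1 := two_mul_card_filter_class_level_eq hD h2v hd2 jE hjfix hΘj hjiso hρρ hvρ hΘρ hκ₀ hΘκ₀ hκ₀1 hξ hΘξ hξN' hρc hΘc hc0 Rd hRd1 hRd2 hRd3 hn hi1
        (by omega) (by omega)
      have h2 := congrArg (fun x : ℕ => (x : ℤ)) h1
      push_cast [Nat.cast_sub hq1] at h2
      exact h2
    · rw [hLit i (h' * ρ h'), hlevel i hi1 (by omega)]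
      have h1 := two_mul_card_filter_class_level_eq hD h2v hd2 jE hjfix hΘj hjiso hρρ hvρ hΘρ hκ₀ hΘκ₀ hκ₀1 hξ hΘξ hξN' hρc' hΘc' hc0' Rd hRd1 hRd2 hRd3 hn hi1
        (by omega) (by omega)
      have h2 := congrArg (fun x : ℕ => (x : ℤ)) h1
      push_cast [Nat.cast_sub hq1] at h2
      exact h2
  -- (LBd) the boundary shell splits `(q − 2) : q`
  · intro i hi1 hid hiN
    obtain ⟨A₀, hA₀⟩ := exists_slope jE hjfix hρρ (κ₀ := κ₀) hξ hξ0
    rw [hLit i (h * ρ h), hLit i (h' * ρ h'), hlevel i hi1 (by omega)]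
    have hH := two_mul_card_filter_class_boundary hD h2v hd2 jE hjfix hΘj hjiso hρρ hvρ hΘρ φ hform hκ₀ hΘκ₀ hκ₀1 hξ hΘξ hξN' hA₀ Rd hRd1 hRd2 hRd3 (N - 1 - i)
      (by omega) (by omega)
    have hA' := two_mul_card_filter_class'_boundary hD h2v hd2 jE hjfix hΘj hjiso hρρ hvρ hΘρ P₁ dg η hA hηN φ hform hΘh hh φ' hform' hΘh' hh' hκ₀ hΘκ₀ hκ₀1 hξ hΘξ
      hξN' hA₀ Rd hRd1 hRd2 hRd3 (N - 1 - i) (by omega) (by omega)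
    obtain ⟨e1, e2⟩ := hLBd_of_boundary (hshell i hi1 (by omega)) hH hA'
    exact ⟨by rw [e1, mul_assoc], by rw [e2, ← mul_assoc, ← pow_succ', Nat.sub_add_cancel hi1]⟩
  -- (LFar) the far shells are one-class
  · intro i hi1 hdi hiN
    rw [hLit i (h * ρ h), hLit i (h' * ρ h'), hlevel i hi1 (by omega)]
    have hS : ∀ V ∈ Rd.filter (fun V => Valued.v V = Valued.v ϖ ^ (2 * (N - 1 - i))), σ V = V ∧ exp (2 * (d : ℤ) - 1) ≤ Valued.v V * Valued.v ξ₀ := by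
      intro V hV
      obtain ⟨hVR, hVv⟩ := Finset.mem_filter.1 hV
      refine ⟨(hRd1 V hVR).1, ?_⟩
      rw [hVv, hξN', hϖn, ← exp_add, exp_le_exp]; push_cast; omega
    obtain ⟨e1, e2⟩ := filter_class_of_far hD jE hjfix hΘj hjiso hρρ hvρ hΘρ P₁ dg η hA hηN φ hform hΘh hh φ' hform' hΘh' hh' hκ₀ hΘκ₀ hκ₀1 hξ hΘξ _ hS
    rw [e1, e2, Finset.card_empty, Nat.cast_zero, hshell i hi1 (by omega), mul_assoc]
    exact ⟨rfl, rfl⟩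

end Summit.HodgeConjecture.HodgeConjecture.Cruxes.H413.F0P3cDyRamInsideCellsDensity

end
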